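import Summits.Ventures.PercRepro.PuncturedLYMSuperMain
import Summits.Ventures.PercRepro.ProfileBiIndepNormConsBoolean

/-!
# PercRepro — THE SPARSE-PAVING BRIDGE: (SP) FOR THE CO-CIRCUIT CODE IS THE BOTTOM STEP OF (NC), AND (NC) HOLDS FOR EVERY
SPARSE PAVING MATROID ON `n ≤ (3r + 1)/2` ELEMENTS (p10, gen 31)

In the kernel's vocabulary (`rk M S = S.card` = «`S` is independent»), a matroid `M` on `E = univ` is SPARSE PAVING of rank
`r` when every `(r−1)`-subset is independent and two distinct dependent `r`-subsets meet in at most `r − 2` points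
(`IsSparsePavingF`).  Its CO-CODE is the family of complements of the dependent `r`-sets (`cocode`, sets of size `j = n − r`);
it is a code in the sense of PuncturedLYM (`isCode_cocode`: two complements meet in `n − 2r + #(S ∩ T) ≤ j − 2` points).
For `n ≤ 2r − 2`:
* `biIndepSets_eq_punctured` — the bi-independent `j`-sets are exactly the punctured level `P = C(E, j) ∖ cocode`
  (a `j`-set is independent since `j ≤ r − 1`; its complement is an `r`-set, independent iff not in the co-code);
* `biIndepSets_succ_eq_levelAbove` — the bi-independent `(j+1)`-sets are all the `(j+1)`-sets;
* `clF_eq_self_of_card_eq` — every `j`-set is its own closure (`j + 1 ≤ r − 1`);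
* **`normConsStep_bottom_of_puncturedNMP`** — the step of (NC) at the bottom level `j = n − r` follows from (SP) for the
  co-code: `u_j(U) = #(P ∩ U)`, and every `(j+1)`-set above a member of `P ∩ U` has its closure in `U` (up-closure), so
  `u_{j+1}(U) ≥ #N(P ∩ U)`;
* **`normConsAt_of_sparsePaving`** — with THEOREM A (`puncturedNMP_of_three_j`) and the unconditional steps of gen 29
  (`normConsStep_of_lt` below the bottom, the Boolean steps `normConsStep_of_indep_succ_of_indep_sdiff` on
  `n − r + 1 ≤ j ≤ r − 2`, `normConsStep_of_rk_le` at and above `r − 1`): **(NC) holds for every sparse paving matroid on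
  `E = univ` with `r + 1 ≤ n`, `n + 2 ≤ 2r` and `3(n − r) ≤ n + 1`** — i.e. `n ≤ (3r + 1)/2`.
Nothing here asserts (NC) or (SP) in general.
-/

open scoped Matroid

namespace PercRepro.Cogirth

open Finset ThmH Skew

variable {α : Type} [Fintype α] [DecidableEq α] {M : Matroid α} [M.Finite]

/-! ### Sparse paving matroids and their co-codes -/

/-- `M` is SPARSE PAVING of rank `r`: the ground set has rank `r`, every `(r−1)`-subset is independent, and two distinct
dependent `r`-subsets meet in at most `r − 2` points. -/
def IsSparsePavingF (M : Matroid α) [M.Finite] (r : ℕ) : Prop :=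
  rk M (gr M) = r ∧ (∀ S ⊆ gr M, S.card + 1 = r → rk M S = S.card) ∧
    ∀ S ⊆ gr M, ∀ T ⊆ gr M, S.card = r → T.card = r → rk M S ≠ S.card → rk M T ≠ T.card → S ≠ T →
      (S ∩ T).card + 2 ≤ r

/-- The CO-CODE of `M` at rank `r`: the complements (sets of size `n − r`) of the dependent `r`-subsets. -/
noncomputable def cocode (M : Matroid α) [M.Finite] (r : ℕ) : Finset (Finset α) :=
  ((gr M).powersetCard ((gr M).card - r)).filter (fun X => rk M (gr M \ X) ≠ (gr M \ X).card)

omit [Fintype α] in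
/-- Membership in the co-code. -/
theorem mem_cocode {r : ℕ} {X : Finset α} :
    X ∈ cocode M r ↔ (X ⊆ gr M ∧ X.card = (gr M).card - r) ∧ rk M (gr M \ X) ≠ (gr M \ X).card := by
  unfold cocode
  rw [mem_filter, mem_powersetCard]

omit [Fintype α] in
/-- In a sparse paving matroid of rank `r` (`r ≤ n`) every subset with at most `r − 1` elements is independent. -/
theorem rk_eq_card_of_card_lt_of_sparsePaving {r : ℕ} (hsp : IsSparsePavingF M r) (hr : r ≤ (gr M).card)
    {S : Finset α} (hS : S ⊆ gr M) (hSc : S.card + 1 ≤ r) : rk M S = S.card := by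
  apply rk_eq_card_of_card_le_of_indep (m := r - 1) (by omega) _ hS (by omega)
  intro T hT hTc
  exact hsp.2.1 T hT (by omega)

omit [Fintype α] in
/-- **The co-code is a code** of `(n − r)`-sets (`r ≤ n`). -/
theorem isCode_cocode {r : ℕ} (hsp : IsSparsePavingF M r) (hr : r ≤ (gr M).card) :
    PuncturedLYM.IsCode ((gr M).card - r) (cocode M r) := by
  refine ⟨fun X hX => (mem_cocode.1 hX).1.2, ?_⟩
  intro X hX X' hX' hne
  obtain ⟨⟨hXg, hXc⟩, hXd⟩ := mem_cocode.1 hX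
  obtain ⟨⟨hX'g, hX'c⟩, hX'd⟩ := mem_cocode.1 hX'
  set S := gr M \ X with hS
  set T := gr M \ X' with hT
  have hSc : S.card = r := by
    rw [hS, card_sdiff_of_subset hXg, hXc]
    omega
  have hTc : T.card = r := by
    rw [hT, card_sdiff_of_subset hX'g, hX'c]
    omega
  have hST : S ≠ T := by
    intro h
    apply hne
    have h1 : gr M \ S = X := by rw [hS, Finset.sdiff_sdiff_eq_self hXg]
    have h2 : gr M \ T = X' := by rw [hT, Finset.sdiff_sdiff_eq_self hX'g]
    rw [← h1, ← h2, h]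
  have hint := hsp.2.2 S sdiff_subset T sdiff_subset hSc hTc hXd hX'd hST
  -- `X ∩ X' = gr ∖ (S ∪ T)`, so `#(X ∩ X') = n − (2r − #(S ∩ T))`
  have hXX' : X ∩ X' = gr M \ (S ∪ T) := by
    rw [hS, hT]
    ext w
    simp only [mem_inter, mem_sdiff, mem_union, not_or, not_and, not_not]
    constructor
    · rintro ⟨hw1, hw2⟩
      exact ⟨hXg hw1, fun _ => hw1, fun _ => hw2⟩
    · rintro ⟨hwg, hw1, hw2⟩
      exact ⟨hw1 hwg, hw2 hwg⟩
  have hSTu : (S ∪ T).card + (S ∩ T).card = 2 * r := by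
    have := card_union_add_card_inter S T
    omega
  have hSTg : S ∪ T ⊆ gr M := union_subset sdiff_subset sdiff_subset
  have hcard : (X ∩ X').card + (S ∪ T).card = (gr M).card := by
    rw [hXX', card_sdiff_of_subset hSTg]
    have := card_le_card hSTg
    omega
  omega

/-! ### The bottom level: bi-independent sets, closures, counts -/

/-- The bi-independent `(n − r)`-sets are the punctured level of the co-code (`E = univ`, `n + 2 ≤ 2r`). -/
theorem biIndepSets_eq_punctured {r : ℕ} (hsp : IsSparsePavingF M r) (hE : gr M = univ)
    (hn : (gr M).card + 2 ≤ 2 * r) :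
    biIndepSets M ((gr M).card - r) = PuncturedLYM.punctured ((gr M).card - r) (cocode M r) := by
  have hr : r ≤ (gr M).card := by
    have := hsp.1 ▸ rk_le_card (gr M)
    omega
  ext X
  rw [mem_biIndepSets, PuncturedLYM.mem_punctured, mem_cocode]
  constructor
  · rintro ⟨hXg, hXc, -, hXd⟩
    refine ⟨hXc, ?_⟩
    rintro ⟨-, h⟩
    exact h hXd
  · rintro ⟨hXc, hXD⟩
    have hXg : X ⊆ gr M := by rw [hE]; exact subset_univ X
    refine ⟨hXg, hXc, rk_eq_card_of_card_lt_of_sparsePaving hsp hr hXg (by omega), ?_⟩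
    by_contra h
    exact hXD ⟨⟨hXg, hXc⟩, h⟩

/-- The bi-independent `(n − r + 1)`-sets are all the `(n − r + 1)`-sets (`E = univ`, `n + 2 ≤ 2r`). -/
theorem biIndepSets_succ_eq_levelAbove {r : ℕ} (hsp : IsSparsePavingF M r) (hE : gr M = univ)
    (hn : (gr M).card + 2 ≤ 2 * r) :
    biIndepSets M ((gr M).card - r + 1) = PuncturedLYM.levelAbove α ((gr M).card - r) := by
  have hr : r ≤ (gr M).card := by
    have := hsp.1 ▸ rk_le_card (gr M)
    omega
  rw [PuncturedLYM.levelAbove, ← hE]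
  apply biIndepSets_eq_powersetCard_of_indep_of_indep
  · intro S hS hSc
    exact rk_eq_card_of_card_lt_of_sparsePaving hsp hr hS (by omega)
  · intro S hS hSc
    exact rk_eq_card_of_card_lt_of_sparsePaving hsp hr hS (by omega)

omit [Fintype α] in
/-- Every `(n − r)`-set is its own closure (`n + 2 ≤ 2r`). -/
theorem clF_eq_self_of_card_eq {r : ℕ} (hsp : IsSparsePavingF M r) (hn : (gr M).card + 2 ≤ 2 * r)
    {X : Finset α} (hX : X ⊆ gr M) (hXc : X.card = (gr M).card - r) : clF M X = X := by
  have hr : r ≤ (gr M).card := by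
    have := hsp.1 ▸ rk_le_card (gr M)
    omega
  apply clF_eq_self_of_indep_succ' _ hX hXc
  intro S hS hSc
  exact rk_eq_card_of_card_lt_of_sparsePaving hsp hr hS (by omega)

/-- **The bottom step of (NC) follows from (SP) for the co-code** (`E = univ`, `n + 2 ≤ 2r`). -/
theorem normConsStep_bottom_of_puncturedNMP {r : ℕ} (hsp : IsSparsePavingF M r) (hE : gr M = univ)
    (hn : (gr M).card + 2 ≤ 2 * r) {U : Finset (Finset α)} (hU : UpFlats M U)
    (hSP : PuncturedLYM.PuncturedNMP ((gr M).card - r) (cocode M r)) :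
    NormConsStep M U ((gr M).card - r) := by
  set j := (gr M).card - r with hj
  unfold NormConsStep upCount
  rw [biIndepSets_eq_punctured hsp hE hn, biIndepSets_succ_eq_levelAbove hsp hE hn]
  -- the bottom count is `#(P ∩ U)`
  set 𝒜 := (PuncturedLYM.punctured j (cocode M r)).filter (fun X => X ∈ U) with h𝒜
  have h𝒜P : 𝒜 ⊆ PuncturedLYM.punctured j (cocode M r) := filter_subset _ _
  have hbot : (PuncturedLYM.punctured j (cocode M r)).filter (fun X => clF M X ∈ U) = 𝒜 := by
    apply filter_congr
    intro X hX
    have hXc := (PuncturedLYM.mem_punctured.1 hX).1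
    have hXg : X ⊆ gr M := by rw [hE]; exact subset_univ X
    rw [clF_eq_self_of_card_eq hsp hn hXg hXc]
  rw [hbot]
  -- every `(j+1)`-set above a member of `𝒜` has its closure in `U`
  have hup : PuncturedLYM.upNbhd j 𝒜 ⊆ (PuncturedLYM.levelAbove α j).filter (fun Y => clF M Y ∈ U) := by
    intro Y hY
    rw [PuncturedLYM.mem_upNbhd] at hY
    obtain ⟨hYc, X, hX𝒜, hXY⟩ := hY
    rw [mem_filter, PuncturedLYM.mem_levelAbove]
    refine ⟨hYc, ?_⟩
    have hXU : X ∈ U := (mem_filter.1 hX𝒜).2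
    have hYg : Y ⊆ gr M := by rw [hE]; exact subset_univ Y
    have hXcl : X ⊆ clF M Y := hXY.trans (subset_clF_fu hYg)
    exact hU.up X hXU (clF M Y) (isFlatF_clF Y) hXcl
  have h1 := hSP 𝒜 h𝒜P
  have h2 := card_le_card hup
  calc 𝒜.card * (PuncturedLYM.levelAbove α j).card
      ≤ (PuncturedLYM.upNbhd j 𝒜).card * (PuncturedLYM.punctured j (cocode M r)).card := h1
    _ ≤ ((PuncturedLYM.levelAbove α j).filter (fun Y => clF M Y ∈ U)).card *
        (PuncturedLYM.punctured j (cocode M r)).card := Nat.mul_le_mul_right _ h2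

/-! ### (NC) for sparse paving matroids on `n ≤ (3r + 1)/2` elements -/

/-- **(NC) HOLDS FOR EVERY SPARSE PAVING MATROID on `E = univ` with `r + 1 ≤ n`, `n + 2 ≤ 2r` and `3(n − r) ≤ n + 1`**
(THEOREM A at the bottom level, the Boolean and top steps of gen 29 elsewhere). -/
theorem normConsAt_of_sparsePaving {r : ℕ} (hsp : IsSparsePavingF M r) (hE : gr M = univ)
    (hr1 : r + 1 ≤ (gr M).card) (hn : (gr M).card + 2 ≤ 2 * r)
    (h3 : 3 * ((gr M).card - r) ≤ (gr M).card + 1) : NormConsAt M := by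
  intro U hU j
  have hr : r ≤ (gr M).card := by omega
  have hcard : (gr M).card = Fintype.card α := by rw [hE, card_univ]
  rcases Nat.lt_or_ge j ((gr M).card - r) with hlt | hge
  · -- below the bottom level: `j + r < n`
    apply normConsStep_of_lt
    rw [hsp.1]
    omega
  rcases Nat.eq_or_lt_of_le hge with heq | hgt
  · -- the bottom level: THEOREM A for the co-code
    rw [← heq]
    apply normConsStep_bottom_of_puncturedNMP hsp hE hn hU
    have hcode := isCode_cocode hsp hr
    exact PuncturedLYM.puncturedNMP_of_three_j hcode (by omega) (by omega) (by omega)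
  rcases Nat.lt_or_ge (j + 1) r with hmid | htop
  · -- the Boolean levels `n − r + 1 ≤ j ≤ r − 2`
    apply normConsStep_of_indep_succ_of_indep_sdiff hU (by omega)
    · intro S hS hSc
      exact rk_eq_card_of_card_lt_of_sparsePaving hsp hr hS (by omega)
    · intro S hS hSc
      exact rk_eq_card_of_card_lt_of_sparsePaving hsp hr hS (by omega)
  · -- at and above `r − 1`
    apply normConsStep_of_rk_le hU
    rw [hsp.1]
    omega

end PercRepro.Cogirth
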